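import Summits.HodgeConjecture.HodgeConjecture.Theorems.H413E2SW2HFinOfCM
import Summits.HodgeConjecture.HodgeConjecture.Theorems.H413E2SW2FinLevelEigen
import Literature.NumberTheory.Automorphic.UnitaryGroupArchCompactTotallyComplex
import HarnessLib

/-!
# H413 ∕ E-2 road C — `StubSW2` CONJUNCT (ii) AT THE PIN: the orbital sums of the rational orbit terms are locally uniformly bounded,
# for the CM line datum at its chosen splitting (ONE application of ★ `orbitalSums_bounded_of_finIntegrable'`)

Crux H413 (stmt-HodgeConjecture-24833), FLOOR 0, programme P4, engine E-2 child line `F0_E2SiegelWeilWeilRange`, conjunct (ii) of `StubSW2`.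
★ `E2SW2OrbitalSums.orbitalSums_bounded_of_finIntegrable'` (`Theorems/H413E2SW2FinLevelEigen`, F0P2a-p06) proves (ii) for ANY datum GIVEN
`[CompactSpace (U(J_W)(F ⊗ ℝ))]` and the finite-coefficient integrability `hF`.  At the CM line datum `(L⁺, L, c̄, diag dV, diag dW)` (`dW` a real
non-zero line, `n = N·1 ≥ 3`) and its chosen splitting `splittingOf hGR`, both are ★: `[CompactSpace …]` by ★ `UnitaryGroup.compactSpace_arch_rankOne`
(`L⁺` totally real, `L` totally complex, rank one — A-p10), `hF` by ★ `ThetaNonvanishing.hF_cm_splittingOf` (`Theorems/H413E2SW2HFinOfCM`).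

* **`orbitalSums_bounded_cm_splittingOf`** — for every additive Haar `ν_X` on `𝔸_{L⁺}ⁿ` making `ω = pairRep (splittingOf hGR)` `L²(ν_X)`-isometric
  (`hiso`, the letter's), all `Φ₁ Φ₂ ∈ 𝒮(𝔸ⁿ)` and every compact `C ⊆ U(diag dW)(𝔸)²`: ONE bound `B` with
  `Σ_{γ ∈ U(diag dW)(L⁺)} ‖⟨ω(γ)(ω(x₁⁻¹)Φ₁), ω(x₂⁻¹)Φ₂⟩_{ν_X}‖ ≤ B` (summable) for all `(x₁, x₂) ∈ C` — conjunct (ii) of `StubSW2` at the pin letters.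

KERNEL: one theorem, DEF-FREE, no `sorry`; `--supports stmt-HodgeConjecture-24833 --as helper`; the child-pen (A-p17) folds it.  SCOPE: the pin (CM
line datum, chosen splitting); the letter-generality (ii) is the planners' (A-p17 (g14) 03:01:10Z (γ)).  HC_CM is proved only modulo the printed
citations until rung 0 closes; nothing printed is claimed here.

[cite: Weil1965, n° 51 Thm. 1] [cite: Li1992, Thm 2.1 (25)–(27) p. 184; §5 p. 206]
-/

set_option autoImplicit false
set_option linter.dupNamespace false

noncomputable section

open scoped RestrictedProduct ENNReal NNReal ComplexConjugate Matrix Kronecker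
open MeasureTheory NumberField IsDedekindDomain Filter Function Set Topology
open Literature.NumberTheory.Automorphic Literature.NumberTheory.Automorphic.UnitaryGroup
open Literature.NumberTheory.Weil1964 Literature.NumberTheory.Li1992
open Literature.NumberTheory.GelbartRogawski1991 Literature.NumberTheory.GelbartRogawski1991.UnitaryDualPair
open Literature.NumberTheory.GelbartRogawski1991.UnitaryDualPair.WeilCoinv
open Literature.NumberTheory.GelbartRogawski1991.GRConstruction
open Literature.NumberTheory.Automorphic.Liu2021.Def411WeilCarriersDoubling

namespace Summit.HodgeConjecture.HodgeConjecture.Cruxes.H413.E2SW2OrbitalSums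

section CMLine

variable (L : Type) [Field L] [NumberField L] [IsCMField L] {N n : ℕ} (e : Fin N × Fin 1 ≃ Fin n)
  (dV : Fin N → L) (hdV : ∀ i, IsCMField.complexConj L (dV i) = dV i) (hdV0 : ∀ i, dV i ≠ 0)
  (dW : Fin 1 → L) (hdW : ∀ i, IsCMField.complexConj L (dW i) = dW i) (hdW0 : ∀ i, dW i ≠ 0) (h3 : 3 ≤ n)

set_option maxHeartbeats 1600000 in
-- heartbeats: the statement and the application carry the CM `splittingDatum` telescope (`splittingOf`, `splittingOf_isCompatible`).
include hdV0 hdW0 h3 in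
/-- **`StubSW2` (ii) AT THE PIN — the orbital sums of the rational orbit terms are locally uniformly bounded** for the CM line datum
`(L⁺, L, c̄, diag dV, diag dW)` (`n = N·1 ≥ 3`) at its chosen splitting `ω = pairRep (splittingOf hGR)`: for every additive Haar measure `ν_X` on
`𝔸_{L⁺}ⁿ` for which `ω` is `L²(ν_X)`-isometric, all `Φ₁, Φ₂ ∈ 𝒮(𝔸_{L⁺}ⁿ)` and every compact `C ⊆ U(diag dW)(𝔸_{L⁺})²`, there is ONE `B` with
`Σ_{γ ∈ U(diag dW)(L⁺)} ‖⟨ω(γ)(ω(x₁⁻¹)Φ₁), ω(x₂⁻¹)Φ₂⟩_{ν_X}‖` summable and `≤ B` for all `(x₁, x₂) ∈ C` — ★ `orbitalSums_bounded_of_finIntegrable'`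
with `[CompactSpace (U(diag dW)(L⁺ ⊗ ℝ))]` (★ `compactSpace_arch_rankOne`) and `hF` (★ `hF_cm_splittingOf`).
[cite: Weil1965, n° 51 Thm. 1] [cite: Li1992, Thm 2.1 (25)–(27) p. 184; §5 p. 206] -/
theorem orbitalSums_bounded_cm_splittingOf (hGR : (cmSplittingDatum L e dV hdV hdV0 dW hdW hdW0).CompatibleSplitting)
    [MeasurableSpace (AdeleRing (𝓞 (Fp L)) (Fp L))] [BorelSpace (AdeleRing (𝓞 (Fp L)) (Fp L))]
    (νX : Measure (Fin n → AdeleRing (𝓞 (Fp L)) (Fp L))) [νX.IsAddHaarMeasure]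
    (hiso : ∀ (p : UnitaryGroup.adelic (Fp L) L (IsCMField.complexConj L) N (Matrix.diagonal dV) ×
          UnitaryGroup.adelic (Fp L) L (IsCMField.complexConj L) 1 (Matrix.diagonal dW)) (Φ : piSchwartzBruhat (Fp L) (Fin n)),
      ∫⁻ x, ‖((pairRep (Fp L) L (IsCMField.complexConj L) N 1 e (Matrix.diagonal dV) (Matrix.diagonal dW)
          (splittingOf (Fp L) L (IsCMField.complexConj L) N 1 e (Matrix.diagonal dV) (Matrix.diagonal dW)
        (complexConj_imagUnit L) (imagUnit_ne_zero L) (imagUnit_mul_self L) (realDiagonal_isSymm L dV hdV) (realDiagonal_isSymm L dW hdW)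
        (isUnit_det_realDiagonal L dV hdV hdV0) (isUnit_det_realDiagonal L dW hdW hdW0) (realDiagonal_map L dV hdV).symm
        (realDiagonal_map L dW hdW).symm hGR) p Φ : piSchwartzBruhat (Fp L) (Fin n)) :
          (Fin n → AdeleRing (𝓞 (Fp L)) (Fp L)) → ℂ) x‖ₑ ^ 2 ∂νX =
        ∫⁻ x, ‖(Φ : (Fin n → AdeleRing (𝓞 (Fp L)) (Fp L)) → ℂ) x‖ₑ ^ 2 ∂νX)
    (Φ₁ Φ₂ : piSchwartzBruhat (Fp L) (Fin n))
    (C : Set (UnitaryGroup.adelic (Fp L) L (IsCMField.complexConj L) 1 (Matrix.diagonal dW) ×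
      UnitaryGroup.adelic (Fp L) L (IsCMField.complexConj L) 1 (Matrix.diagonal dW))) (hC : IsCompact C) :
    ∃ B : ℝ, ∀ (x₁ x₂ : UnitaryGroup.adelic (Fp L) L (IsCMField.complexConj L) 1 (Matrix.diagonal dW)), (x₁, x₂) ∈ C →
      Summable (fun γ : (UnitaryGroup.toAdelic (Fp L) L (IsCMField.complexConj L) 1 (Matrix.diagonal dW)).range =>
        ‖schwartzPairing (Fp L) (Fin n) νX
            (pairRep (Fp L) L (IsCMField.complexConj L) N 1 e (Matrix.diagonal dV) (Matrix.diagonal dW)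
              (splittingOf (Fp L) L (IsCMField.complexConj L) N 1 e (Matrix.diagonal dV) (Matrix.diagonal dW)
        (complexConj_imagUnit L) (imagUnit_ne_zero L) (imagUnit_mul_self L) (realDiagonal_isSymm L dV hdV) (realDiagonal_isSymm L dW hdW)
        (isUnit_det_realDiagonal L dV hdV hdV0) (isUnit_det_realDiagonal L dW hdW hdW0) (realDiagonal_map L dV hdV).symm
        (realDiagonal_map L dW hdW).symm hGR)
              (1, (γ : UnitaryGroup.adelic (Fp L) L (IsCMField.complexConj L) 1 (Matrix.diagonal dW)))
              (pairRep (Fp L) L (IsCMField.complexConj L) N 1 e (Matrix.diagonal dV) (Matrix.diagonal dW)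
                (splittingOf (Fp L) L (IsCMField.complexConj L) N 1 e (Matrix.diagonal dV) (Matrix.diagonal dW)
        (complexConj_imagUnit L) (imagUnit_ne_zero L) (imagUnit_mul_self L) (realDiagonal_isSymm L dV hdV) (realDiagonal_isSymm L dW hdW)
        (isUnit_det_realDiagonal L dV hdV hdV0) (isUnit_det_realDiagonal L dW hdW hdW0) (realDiagonal_map L dV hdV).symm
        (realDiagonal_map L dW hdW).symm hGR) (1, x₁⁻¹) Φ₁))
            (pairRep (Fp L) L (IsCMField.complexConj L) N 1 e (Matrix.diagonal dV) (Matrix.diagonal dW)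
              (splittingOf (Fp L) L (IsCMField.complexConj L) N 1 e (Matrix.diagonal dV) (Matrix.diagonal dW)
        (complexConj_imagUnit L) (imagUnit_ne_zero L) (imagUnit_mul_self L) (realDiagonal_isSymm L dV hdV) (realDiagonal_isSymm L dW hdW)
        (isUnit_det_realDiagonal L dV hdV hdV0) (isUnit_det_realDiagonal L dW hdW hdW0) (realDiagonal_map L dV hdV).symm
        (realDiagonal_map L dW hdW).symm hGR) (1, x₂⁻¹) Φ₂)‖) ∧
      ∑' γ : (UnitaryGroup.toAdelic (Fp L) L (IsCMField.complexConj L) 1 (Matrix.diagonal dW)).range,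
        ‖schwartzPairing (Fp L) (Fin n) νX
            (pairRep (Fp L) L (IsCMField.complexConj L) N 1 e (Matrix.diagonal dV) (Matrix.diagonal dW)
              (splittingOf (Fp L) L (IsCMField.complexConj L) N 1 e (Matrix.diagonal dV) (Matrix.diagonal dW)
        (complexConj_imagUnit L) (imagUnit_ne_zero L) (imagUnit_mul_self L) (realDiagonal_isSymm L dV hdV) (realDiagonal_isSymm L dW hdW)
        (isUnit_det_realDiagonal L dV hdV hdV0) (isUnit_det_realDiagonal L dW hdW hdW0) (realDiagonal_map L dV hdV).symm
        (realDiagonal_map L dW hdW).symm hGR)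
              (1, (γ : UnitaryGroup.adelic (Fp L) L (IsCMField.complexConj L) 1 (Matrix.diagonal dW)))
              (pairRep (Fp L) L (IsCMField.complexConj L) N 1 e (Matrix.diagonal dV) (Matrix.diagonal dW)
                (splittingOf (Fp L) L (IsCMField.complexConj L) N 1 e (Matrix.diagonal dV) (Matrix.diagonal dW)
        (complexConj_imagUnit L) (imagUnit_ne_zero L) (imagUnit_mul_self L) (realDiagonal_isSymm L dV hdV) (realDiagonal_isSymm L dW hdW)
        (isUnit_det_realDiagonal L dV hdV hdV0) (isUnit_det_realDiagonal L dW hdW hdW0) (realDiagonal_map L dV hdV).symm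
        (realDiagonal_map L dW hdW).symm hGR) (1, x₁⁻¹) Φ₁))
            (pairRep (Fp L) L (IsCMField.complexConj L) N 1 e (Matrix.diagonal dV) (Matrix.diagonal dW)
              (splittingOf (Fp L) L (IsCMField.complexConj L) N 1 e (Matrix.diagonal dV) (Matrix.diagonal dW)
        (complexConj_imagUnit L) (imagUnit_ne_zero L) (imagUnit_mul_self L) (realDiagonal_isSymm L dV hdV) (realDiagonal_isSymm L dW hdW)
        (isUnit_det_realDiagonal L dV hdV hdV0) (isUnit_det_realDiagonal L dW hdW hdW0) (realDiagonal_map L dV hdV).symm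
        (realDiagonal_map L dW hdW).symm hGR) (1, x₂⁻¹) Φ₂)‖ ≤ B := by
  haveI := UnitaryGroup.compactSpace_arch_rankOne (Fp L) L (IsCMField.complexConj L) (Matrix.diagonal dW) (complexConj_imagUnit L)
    (imagUnit_ne_zero L) (isUnit_det_realDiagonal L dW hdW hdW0) (realDiagonal_map L dW hdW).symm
  exact orbitalSums_bounded_of_finIntegrable' (Fp L) L (IsCMField.complexConj L) N e (Matrix.diagonal dV) (Matrix.diagonal dW)
    (complexConj_imagUnit L) (imagUnit_ne_zero L) (imagUnit_mul_self L) (realDiagonal_isSymm L dV hdV) (realDiagonal_isSymm L dW hdW)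
    (isUnit_det_realDiagonal L dV hdV hdV0) (isUnit_det_realDiagonal L dW hdW hdW0) (realDiagonal_map L dV hdV).symm
    (realDiagonal_map L dW hdW).symm
    (splittingOf_isCompatible (Fp L) L (IsCMField.complexConj L) N 1 e (Matrix.diagonal dV) (Matrix.diagonal dW)
        (complexConj_imagUnit L) (imagUnit_ne_zero L) (imagUnit_mul_self L) (realDiagonal_isSymm L dV hdV) (realDiagonal_isSymm L dW hdW)
        (isUnit_det_realDiagonal L dV hdV hdV0) (isUnit_det_realDiagonal L dW hdW hdW0) (realDiagonal_map L dV hdV).symm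
        (realDiagonal_map L dW hdW).symm hGR)
    νX hiso (ThetaNonvanishing.hF_cm_splittingOf L e dV hdV hdV0 dW hdW hdW0 h3 hGR) Φ₁ Φ₂ C hC

end CMLine

end Summit.HodgeConjecture.HodgeConjecture.Cruxes.H413.E2SW2OrbitalSums

end
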